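import Literature.NumberTheory.LFunctions.SiegelWalfiszMoebius
import Literature.NumberTheory.Sieve.BombieriAsymptoticSieveMertens
import Literature.NumberTheory.Sieve.CoprimeSquarefreeSums
import Literature.NumberTheory.Sieve.PrimePowersInProgressions
import HarnessLib

/-!
# Möbius sums in arithmetic progressions with a coprimality condition

Trunk `AntSieve`.  A PROVED consequence of the Siegel–Walfisz theorem for `μ` (named fact
`Literature.NumberTheory.LFunctions.SiegelWalfiszMoebius`, Montgomery–Vaughan §11.3): for `k ≤ (log y)^A`, `(a, k) = 1` and any
`q ≥ 1`,
`|∑_{n ≤ y, n ≡ a (k), (n, q) = 1} μ(n)| ≤ C_{A,B} 4^{ω(q)} y (log y)^{−B}`.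
This is the form in which "hypothesis (A₂) … is a consequence of the Siegel–Walfisz theorem"
(Bombieri–Friedlander–Iwaniec, Acta Math. 156 (1986), §15 p. 246) for the Möbius pieces of the
Heath-Brown identity: (A₂) (p. 206) carries the extra condition `(n, d) = 1`.

Method (standard): the friable expansion `μ · 1_{(·,q)=1} = μ ⋆ 1_{q-friable}`
(`moebiusCoprime_eq_moebius_mul_friable`, an identity of multiplicative functions checked on prime
powers), so that `∑_{n ≤ y, n≡a(k), (n,q)=1} μ(n) = ∑_{t q-friable} ∑_{w ≤ y/t, tw ≡ a (k)} μ(w)`; for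
`t ≤ √y` the inner sum is a Möbius sum in a progression of length `≥ √y` (Siegel–Walfisz), for
`t > √y` it is at most `y/t ≤ y^{3/4} t^{−1/2}`; in both ranges the weight `t^{−1/2}` (`1/t ≤ t^{−1/2}`)
is summed by `∑_{t q-friable} t^{−1/2} ≤ ∏_{p ∣ q} (1 − p^{−1/2})⁻¹ ≤ 4^{ω(q)}`.

## Contents

* `Literature.friable q` (the indicator of Mathlib's `Nat.factoredNumbers q.primeFactors`,
  `friable_eq_ite_mem_factoredNumbers`), `Literature.moebiusCoprime q`, their multiplicativity, and
  `Literature.NumberTheory.Sieve.moebiusCoprime_eq_moebius_mul_friable` (prime powers via the tree's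
  `Literature.NumberTheory.Sieve.SquarefreeSums.mul_apply_prime_pow`).
* `Literature.NumberTheory.Sieve.sum_Icc_mul_dirichlet_eq` — `∑_{n ≤ N} c(n) (f ⋆ g)(n) = ∑_{t ≤ N} f(t) ∑_{w ≤ N/t} g(w) c(tw)`
  (from the tree's `Literature.NumberTheory.Sieve.SquarefreeSums.sum_Icc_sum_divisorsAntidiagonal`).
* `Literature.NumberTheory.Sieve.sum_friable_rpow_neg_half_le`, `Literature.NumberTheory.Sieve.inv_natCast_le_rpow_neg_half` — the Euler-product bound.
* `Literature.NumberTheory.LFunctions.SiegelWalfiszMoebius.sum_coprime_progression_le` — the main estimate.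
* `Literature.NumberTheory.Sieve.two_pow_card_primeFactors_le_sigma_zero`, `Literature.NumberTheory.Sieve.four_pow_card_primeFactors_le_sigma_zero_sq` —
  `2^{ω(q)} ≤ τ(q)`, `4^{ω(q)} ≤ τ(q)²` (from the tree's `Literature.NumberTheory.Sieve.succ_pow_card_primeFactors_le_sum_divisors`).

## References

* H. L. Montgomery, R. C. Vaughan, *Multiplicative Number Theory I*, CUP 2007, §11.3.
  [MontgomeryVaughan2007]
* E. Bombieri, J. B. Friedlander, H. Iwaniec, Acta Math. 156 (1986), §1 (A₂) p. 206, §15 p. 246.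
  [BombieriFriedlanderIwaniecActa1986]
-/

open Finset Real
open scoped ArithmeticFunction.Moebius ArithmeticFunction.omega

namespace Literature.NumberTheory.Sieve

/-! ### The friable expansion `μ · 1_{(·,q)=1} = μ ⋆ 1_{q-friable}` -/

/-- The indicator of the `q`-friable numbers: `friable q t = 1` if `t ≥ 1` and every prime factor
of `t` divides `q`, else `0`. [folklore] -/
noncomputable def friable (q : ℕ) : ArithmeticFunction ℝ where
  toFun t := if t ≠ 0 ∧ t.primeFactors ⊆ q.primeFactors then 1 else 0
  map_zero' := by simp

/-- Unfolding `friable`. [folklore] -/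
theorem friable_apply (q t : ℕ) :
    friable q t = if t ≠ 0 ∧ t.primeFactors ⊆ q.primeFactors then 1 else 0 := rfl

/-- `friable q` is the indicator of Mathlib's `Nat.factoredNumbers q.primeFactors`. [folklore] -/
theorem friable_eq_ite_mem_factoredNumbers (q t : ℕ) :
    friable q t = if t ∈ Nat.factoredNumbers q.primeFactors then 1 else 0 := by
  rw [friable_apply]
  simp only [Nat.mem_factoredNumbers_iff_primeFactors_subset]

/-- `friable q` is multiplicative. [folklore] -/
theorem isMultiplicative_friable (q : ℕ) : (friable q).IsMultiplicative := by
  refine ⟨by simp [friable_apply], fun {m n} hmn => ?_⟩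
  simp only [friable_apply]
  rcases eq_or_ne m 0 with rfl | hm
  · simp
  rcases eq_or_ne n 0 with rfl | hn
  · simp
  have hmn0 : m * n ≠ 0 := mul_ne_zero hm hn
  rw [Nat.primeFactors_mul hm hn]
  by_cases h1 : m.primeFactors ⊆ q.primeFactors <;> by_cases h2 : n.primeFactors ⊆ q.primeFactors <;>
    simp [h1, h2, hm, hn, hmn0, Finset.union_subset_iff]

/-- `μ(n) · 1_{(n,q)=1}` as an arithmetic function. [folklore] -/
noncomputable def moebiusCoprime (q : ℕ) : ArithmeticFunction ℝ where
  toFun n := if n.Coprime q then (μ n : ℝ) else 0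
  map_zero' := by simp

/-- Unfolding `moebiusCoprime`. [folklore] -/
theorem moebiusCoprime_apply (q n : ℕ) :
    moebiusCoprime q n = if n.Coprime q then (μ n : ℝ) else 0 := rfl

/-- `μ · 1_{(·,q)=1}` is multiplicative. [folklore] -/
theorem isMultiplicative_moebiusCoprime (q : ℕ) : (moebiusCoprime q).IsMultiplicative := by
  refine ⟨by simp [moebiusCoprime_apply], fun {m n} hmn => ?_⟩
  simp only [moebiusCoprime_apply]
  rw [ArithmeticFunction.isMultiplicative_moebius.map_mul_of_coprime hmn]
  by_cases h1 : m.Coprime q <;> by_cases h2 : n.Coprime q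
  · rw [if_pos (Nat.Coprime.mul_left h1 h2), if_pos h1, if_pos h2]; push_cast; ring
  · rw [if_neg (fun h => h2 (Nat.Coprime.coprime_mul_left h)), if_neg h2]; ring
  · rw [if_neg (fun h => h1 (Nat.Coprime.coprime_mul_right h)), if_neg h1]; ring
  · rw [if_neg (fun h => h1 (Nat.Coprime.coprime_mul_right h)), if_neg h1]; ring

/-- **The friable expansion**: `μ(n) 1_{(n,q)=1} = ∑_{t ∣ n, t q-friable} μ(n/t)`, i.e.
`μ · 1_{(·,q)=1} = μ ⋆ 1_{q-friable}` (both sides are multiplicative; at `p^i` with `p ∤ q` both are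
`μ(p^i)`, with `p ∣ q`, `i ≥ 1`, both vanish: `∑_{j ≤ i} μ(p^j) = 1 − 1 = 0`). [folklore] -/
theorem moebiusCoprime_eq_moebius_mul_friable {q : ℕ} (hq : q ≠ 0) :
    moebiusCoprime q = (μ : ArithmeticFunction ℝ) * friable q := by
  rw [ArithmeticFunction.IsMultiplicative.eq_iff_eq_on_prime_powers _ (isMultiplicative_moebiusCoprime q)
    _ (ArithmeticFunction.isMultiplicative_moebius.intCast.mul (isMultiplicative_friable q))]
  intro p i hp
  rw [SquarefreeSums.mul_apply_prime_pow _ _ hp, moebiusCoprime_apply]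
  rcases Nat.eq_zero_or_pos i with rfl | hi
  · simp [friable_apply]
  by_cases hpq : p ∣ q
  · -- `p ∣ q`: left side `0`, right side `∑_{j ≤ i} μ(p^j) = 0`
    have hnc : ¬ (p ^ i).Coprime q := by
      intro h
      have := Nat.Coprime.coprime_dvd_left (dvd_pow_self p hi.ne') h
      exact (Nat.Prime.coprime_iff_not_dvd hp).1 this hpq
    rw [if_neg hnc]
    have hfr : ∀ m : ℕ, friable q (p ^ m) = 1 := by
      intro m
      rw [friable_apply, if_pos]
      refine ⟨pow_ne_zero _ hp.ne_zero, ?_⟩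
      rcases Nat.eq_zero_or_pos m with rfl | hm
      · simp
      · rw [Nat.primeFactors_prime_pow hm.ne' hp, Finset.singleton_subset_iff]
        exact Nat.mem_primeFactors.2 ⟨hp, hpq, hq⟩
    simp_rw [hfr, mul_one]
    rw [Finset.sum_range_succ']
    simp only [pow_zero, ArithmeticFunction.intCoe_apply, ArithmeticFunction.moebius_apply_one,
      Int.cast_one]
    have : ∑ j ∈ Finset.range i, ((μ (p ^ (j + 1)) : ℤ) : ℝ) = -1 := by
      have h1 : ∀ j ∈ Finset.range i, ((μ (p ^ (j + 1)) : ℤ) : ℝ) = if j = 0 then -1 else 0 := by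
        intro j _
        rw [ArithmeticFunction.moebius_apply_prime_pow hp (Nat.succ_ne_zero j)]
        by_cases hj0 : j = 0 <;> simp [hj0]
      rw [Finset.sum_congr rfl h1, Finset.sum_ite_eq']
      simp [hi]
    rw [this]; ring
  · -- `p ∤ q`: only `j = i` contributes
    have hc : (p ^ i).Coprime q := Nat.Coprime.pow_left i ((Nat.Prime.coprime_iff_not_dvd hp).2 hpq)
    rw [if_pos hc]
    have hfr : ∀ m : ℕ, friable q (p ^ m) = if m = 0 then 1 else 0 := by
      intro m
      rw [friable_apply]
      rcases Nat.eq_zero_or_pos m with rfl | hm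
      · simp
      · rw [if_neg, if_neg hm.ne']
        rintro ⟨-, hsub⟩
        rw [Nat.primeFactors_prime_pow hm.ne' hp, Finset.singleton_subset_iff] at hsub
        exact hpq (Nat.dvd_of_mem_primeFactors hsub)
    simp_rw [hfr]
    rw [Finset.sum_eq_single i]
    · simp
    · intro j hj hji
      rw [Finset.mem_range, Nat.lt_succ_iff] at hj
      have : i - j ≠ 0 := Nat.sub_ne_zero_of_lt (lt_of_le_of_ne hj hji)
      simp [this]
    · intro h; exact absurd (Finset.self_mem_range_succ i) h

/-- Pointwise form of the friable expansion: for `q ≠ 0` and every `n`,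
`(if (n,q)=1 then μ(n) else 0) = (μ ⋆ friable q)(n)`. [folklore] -/
theorem moebius_coprime_indicator_eq {q : ℕ} (hq : q ≠ 0) (n : ℕ) :
    (if n.Coprime q then (μ n : ℝ) else 0) = ((μ : ArithmeticFunction ℝ) * friable q) n := by
  rw [← moebiusCoprime_apply, moebiusCoprime_eq_moebius_mul_friable hq]

/-! ### Opening a Dirichlet product against a weight -/

/-- `∑_{n ≤ N} c(n) (f ⋆ g)(n) = ∑_{t ≤ N} f(t) ∑_{w ≤ N/t} g(w) c(tw)` (group the pairs `tw = n` by
`t`); a corollary of the tree's hyperbola rearrangement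
`Literature.NumberTheory.Sieve.SquarefreeSums.sum_Icc_sum_divisorsAntidiagonal`. [folklore] -/
theorem sum_Icc_mul_dirichlet_eq (f g : ArithmeticFunction ℝ) (c : ℕ → ℝ) (N : ℕ) :
    ∑ n ∈ Icc 1 N, c n * (f * g) n = ∑ t ∈ Icc 1 N, f t * ∑ w ∈ Icc 1 (N / t), g w * c (t * w) := by
  have h1 : ∑ n ∈ Icc 1 N, c n * (f * g) n =
      ∑ n ∈ Icc 1 N, ∑ q ∈ n.divisorsAntidiagonal, f q.1 * (g q.2 * c (q.1 * q.2)) := by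
    refine Finset.sum_congr rfl fun n _ => ?_
    rw [ArithmeticFunction.mul_apply, Finset.mul_sum]
    refine Finset.sum_congr rfl fun q hq => ?_
    rw [(Nat.mem_divisorsAntidiagonal.1 hq).1]
    ring
  rw [h1, SquarefreeSums.sum_Icc_sum_divisorsAntidiagonal (fun d e => f d * (g e * c (d * e))) N]
  refine Finset.sum_congr rfl fun t _ => ?_
  rw [Finset.mul_sum]

/-! ### Euler-product bounds over `q`-friable numbers -/

/-- `∑_{t ≤ N, t q-friable} t^{−1/2} ≤ ∏_{p ∣ q} (1 − p^{−1/2})⁻¹ ≤ 4^{ω(q)}` (Euler product over the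
`q.primeFactors`-factored numbers; `(1 − p^{−1/2})⁻¹ ≤ 4` for `p ≥ 2`). [folklore] -/
theorem sum_friable_rpow_neg_half_le (q N : ℕ) :
    ∑ t ∈ (Icc 1 N).filter (fun t : ℕ => t.primeFactors ⊆ q.primeFactors), (t : ℝ) ^ (-(1 / 2 : ℝ)) ≤
      (4 : ℝ) ^ q.primeFactors.card := by
  set h : ℕ → ℝ := fun t => (t : ℝ) ^ (-(1 / 2 : ℝ)) with hh
  have h1 : h 1 = 1 := by simp [hh]
  have hmul : ∀ {m n : ℕ}, Nat.Coprime m n → h (m * n) = h m * h n := by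
    intro m n _
    simp only [hh]
    push_cast
    exact Real.mul_rpow (Nat.cast_nonneg m) (Nat.cast_nonneg n)
  have h0 : ∀ n, 0 ≤ h n := fun n => by positivity
  have hgeom : ∀ {p : ℕ}, p.Prime →
      HasSum (fun e : ℕ => h (p ^ e)) (1 - (p : ℝ) ^ (-(1 / 2 : ℝ)))⁻¹ := by
    intro p hp
    have hp0 : (0 : ℝ) ≤ (p : ℝ) ^ (-(1 / 2 : ℝ)) := by positivity
    have hp1 : (p : ℝ) ^ (-(1 / 2 : ℝ)) < 1 :=
      Real.rpow_lt_one_of_one_lt_of_neg (by exact_mod_cast hp.one_lt) (by norm_num)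
    refine (hasSum_geometric_of_lt_one hp0 hp1).congr_fun fun e => ?_
    simp only [hh]
    push_cast
    rw [← Real.rpow_natCast, ← Real.rpow_mul (Nat.cast_nonneg p), mul_comm,
      Real.rpow_mul (Nat.cast_nonneg p), Real.rpow_natCast]
  have hs : ∀ p ∈ q.primeFactors, p.Prime := fun p hp => Nat.prime_of_mem_primeFactors hp
  have hD : ∀ t ∈ (Icc 1 N).filter (fun t : ℕ => t.primeFactors ⊆ q.primeFactors),
      t ∈ Nat.factoredNumbers q.primeFactors := by
    intro t ht
    rw [Finset.mem_filter, Finset.mem_Icc] at ht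
    exact Nat.mem_factoredNumbers_iff_primeFactors_subset.2 ⟨by omega, ht.2⟩
  calc ∑ t ∈ (Icc 1 N).filter (fun t : ℕ => t.primeFactors ⊆ q.primeFactors), (t : ℝ) ^ (-(1 / 2 : ℝ))
      ≤ ∏ p ∈ q.primeFactors, ∑' e : ℕ, h (p ^ e) :=
        BombieriSieve.sum_le_prod_tsum_of_factored h1 hmul h0 (fun hp => (hgeom hp).summable) hs hD
    _ = ∏ p ∈ q.primeFactors, (1 - (p : ℝ) ^ (-(1 / 2 : ℝ)))⁻¹ :=
        Finset.prod_congr rfl fun p hp => (hgeom (hs p hp)).tsum_eq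
    _ ≤ ∏ p ∈ q.primeFactors, (4 : ℝ) := by
        refine Finset.prod_le_prod (fun p hp => ?_) fun p hp => ?_
        · have : (p : ℝ) ^ (-(1 / 2 : ℝ)) < 1 :=
            Real.rpow_lt_one_of_one_lt_of_neg (by exact_mod_cast (hs p hp).one_lt) (by norm_num)
          exact inv_nonneg.2 (by linarith)
        · -- `p^{-1/2} ≤ 2^{-1/2} ≤ 3/4`
          have hp2 : (2 : ℝ) ≤ p := by exact_mod_cast (hs p hp).two_le
          have hle : (p : ℝ) ^ (-(1 / 2 : ℝ)) ≤ (2 : ℝ) ^ (-(1 / 2 : ℝ)) :=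
            Real.rpow_le_rpow_of_nonpos (by norm_num) hp2 (by norm_num)
          have h2 : (2 : ℝ) ^ (-(1 / 2 : ℝ)) ≤ 3 / 4 := by
            rw [Real.rpow_neg (by norm_num), ← Real.sqrt_eq_rpow]
            rw [inv_le_comm₀ (Real.sqrt_pos.2 (by norm_num)) (by norm_num)]
            rw [show ((3 : ℝ) / 4)⁻¹ = 4 / 3 by norm_num]
            rw [Real.le_sqrt (by norm_num) (by norm_num)]
            norm_num
          rw [inv_eq_one_div, div_le_iff₀ (by linarith)]
          linarith
    _ = (4 : ℝ) ^ q.primeFactors.card := Finset.prod_const _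

/-- `t⁻¹ ≤ t^{−1/2}` for natural `t` (both `0` at `t = 0`). [folklore] -/
theorem inv_natCast_le_rpow_neg_half (t : ℕ) : ((t : ℝ))⁻¹ ≤ (t : ℝ) ^ (-(1 / 2 : ℝ)) := by
  rcases Nat.eq_zero_or_pos t with rfl | ht
  · simp
  have ht1 : (1 : ℝ) ≤ t := by exact_mod_cast ht
  rw [← Real.rpow_neg_one]
  exact Real.rpow_le_rpow_of_exponent_le ht1 (by norm_num)

/-- `y^{3/4} ≤ C_B y (log y)^{−B}` for `y ≥ 2` (`B ≥ 0`), with `C_B = (4B)^B`. [folklore] -/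
theorem exists_rpow_three_quarters_le {B : ℝ} (hB : 0 ≤ B) :
    ∃ C : ℝ, 0 ≤ C ∧ ∀ y : ℝ, 2 ≤ y → y ^ (3 / 4 : ℝ) ≤ C * y / Real.log y ^ B := by
  rcases eq_or_lt_of_le hB with rfl | hB0
  · refine ⟨1, zero_le_one, fun y hy => ?_⟩
    rw [Real.rpow_zero, div_one, one_mul]
    calc y ^ (3 / 4 : ℝ) ≤ y ^ (1 : ℝ) := Real.rpow_le_rpow_of_exponent_le (by linarith) (by norm_num)
      _ = y := Real.rpow_one y
  refine ⟨(4 * B) ^ B, by positivity, fun y hy => ?_⟩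
  have hy0 : 0 < y := by linarith
  have hlog : 0 < Real.log y := Real.log_pos (by linarith)
  set ε : ℝ := 1 / (4 * B) with hε
  have hε0 : 0 < ε := by positivity
  have h1 : Real.log y ≤ y ^ ε / ε := Real.log_le_rpow_div hy0.le hε0
  have h2 : Real.log y ^ B ≤ (4 * B) ^ B * y ^ (1 / 4 : ℝ) := by
    calc Real.log y ^ B ≤ (y ^ ε / ε) ^ B := Real.rpow_le_rpow hlog.le h1 hB
      _ = (ε⁻¹) ^ B * (y ^ ε) ^ B := by
          rw [div_eq_mul_inv, Real.mul_rpow (by positivity) (by positivity), mul_comm]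
      _ = (4 * B) ^ B * y ^ (1 / 4 : ℝ) := by
          rw [hε, one_div, inv_inv, ← Real.rpow_mul hy0.le]
          congr 2
          field_simp
  rw [le_div_iff₀ (Real.rpow_pos_of_pos hlog B)]
  calc y ^ (3 / 4 : ℝ) * Real.log y ^ B ≤ y ^ (3 / 4 : ℝ) * ((4 * B) ^ B * y ^ (1 / 4 : ℝ)) :=
        mul_le_mul_of_nonneg_left h2 (by positivity)
    _ = (4 * B) ^ B * (y ^ (3 / 4 : ℝ) * y ^ (1 / 4 : ℝ)) := by ring
    _ = (4 * B) ^ B * y := by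
        rw [← Real.rpow_add hy0]; norm_num

/-! ### The main estimate -/

/-- **Möbius sums in progressions with a coprimality condition** (from Siegel–Walfisz for `μ`):
for `A > 0`, `B ≥ 0` there is `C ≥ 0` such that for all `y ≥ 2`, all `1 ≤ k ≤ (log y)^A`, every
reduced class `a (mod k)` and every `q ≥ 1`,
`|∑_{n ≤ y, n ≡ a (k), (n,q)=1} μ(n)| ≤ C 4^{ω(q)} y (log y)^{−B}`.
PROVED from `Literature.NumberTheory.LFunctions.SiegelWalfiszMoebius` by the friable expansion (module docstring); this is the
Siegel–Walfisz input to hypothesis (A₂) of BFI for the Möbius pieces.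
[cite: MontgomeryVaughan2007, §11.3 Exercise 13(f)] [cite: BombieriFriedlanderIwaniecActa1986, §15 p. 246] -/
theorem _root_.Literature.NumberTheory.LFunctions.SiegelWalfiszMoebius.sum_coprime_progression_le (hSW : LFunctions.SiegelWalfiszMoebius) {A : ℝ}
    (hA : 0 < A) {B : ℝ} (hB : 0 ≤ B) :
    ∃ C : ℝ, 0 ≤ C ∧ ∀ y : ℝ, 2 ≤ y → ∀ k : ℕ, 1 ≤ k → (k : ℝ) ≤ Real.log y ^ A →
      ∀ a : ZMod k, IsUnit a → ∀ q : ℕ, q ≠ 0 →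
        |∑ n ∈ (Icc 1 ⌊y⌋₊).filter (fun n : ℕ => (n : ZMod k) = a ∧ n.Coprime q), (μ n : ℝ)| ≤
          C * (4 : ℝ) ^ q.primeFactors.card * y / Real.log y ^ B := by
  obtain ⟨C₁', hC₁'⟩ := hSW.logPow (A := 2 * A) (by positivity) B
  set C₁ : ℝ := max C₁' 0 with hC₁def
  have hC₁0 : 0 ≤ C₁ := le_max_right _ _
  have hC₁ : ∀ x : ℝ, 2 ≤ x → ∀ q : ℕ, 1 ≤ q → (q : ℝ) ≤ Real.log x ^ (2 * A) → ∀ a : ZMod q,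
      |∑ n ∈ (Icc 1 ⌊x⌋₊).filter (fun n : ℕ => (n : ZMod q) = a), (μ n : ℝ)| ≤
        C₁ * x / Real.log x ^ B := by
    intro x hx q hq hqx a
    refine (hC₁' x hx q hq hqx a).trans ?_
    have : 0 ≤ Real.log x := Real.log_nonneg (by linarith)
    exact div_le_div_of_nonneg_right (mul_le_mul_of_nonneg_right (le_max_left _ _) (by linarith))
      (by positivity)
  obtain ⟨C₂, hC₂0, hC₂⟩ := exists_rpow_three_quarters_le hB
  refine ⟨(4 : ℝ) ^ B + (C₁ * 2 ^ B + C₂), by positivity, fun y hy k hk hky a ha q hq => ?_⟩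
  have hy0 : 0 < y := by linarith
  have hlog0 : 0 < Real.log y := Real.log_pos (by linarith)
  have hω : (1 : ℝ) ≤ (4 : ℝ) ^ q.primeFactors.card := one_le_pow₀ (by norm_num)
  set Y := ⌊y⌋₊ with hY
  have hYy : (Y : ℝ) ≤ y := Nat.floor_le hy0.le
  set S := ∑ n ∈ (Icc 1 Y).filter (fun n : ℕ => (n : ZMod k) = a ∧ n.Coprime q), (μ n : ℝ) with hS
  -- the trivial bound `|S| ≤ y`
  have htriv : |S| ≤ y := by
    calc |S| ≤ ∑ n ∈ (Icc 1 Y).filter (fun n : ℕ => (n : ZMod k) = a ∧ n.Coprime q), |(μ n : ℝ)| :=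
          Finset.abs_sum_le_sum_abs _ _
      _ ≤ ∑ n ∈ (Icc 1 Y).filter (fun n : ℕ => (n : ZMod k) = a ∧ n.Coprime q), (1 : ℝ) := by
          refine Finset.sum_le_sum fun n _ => ?_
          exact_mod_cast ArithmeticFunction.abs_moebius_le_one
      _ = #((Icc 1 Y).filter (fun n : ℕ => (n : ZMod k) = a ∧ n.Coprime q)) := by simp
      _ ≤ #(Icc 1 Y) := by exact_mod_cast Finset.card_le_card (Finset.filter_subset _ _)
      _ = Y := by simp
      _ ≤ y := hYy
  by_cases hsmall : Real.log y ≤ 4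
  · -- small `y`: the trivial bound suffices
    have h4 : Real.log y ^ B ≤ (4 : ℝ) ^ B := Real.rpow_le_rpow hlog0.le hsmall hB
    calc |S| ≤ y := htriv
      _ ≤ (4 : ℝ) ^ B * y / Real.log y ^ B := by
          rw [le_div_iff₀ (Real.rpow_pos_of_pos hlog0 B)]
          rw [mul_comm ((4:ℝ) ^ B) y]
          exact mul_le_mul_of_nonneg_left h4 hy0.le
      _ ≤ ((4 : ℝ) ^ B + (C₁ * 2 ^ B + C₂)) * (4 : ℝ) ^ q.primeFactors.card * y / Real.log y ^ B := by
          refine div_le_div_of_nonneg_right ?_ (by positivity)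
          refine mul_le_mul_of_nonneg_right ?_ hy0.le
          calc (4 : ℝ) ^ B = (4 : ℝ) ^ B * 1 := (mul_one _).symm
            _ ≤ ((4 : ℝ) ^ B + (C₁ * 2 ^ B + C₂)) * (4 : ℝ) ^ q.primeFactors.card :=
                mul_le_mul (le_add_of_nonneg_right (by positivity)) hω zero_le_one (by positivity)
  -- large `y`: the friable expansion
  rw [not_le] at hsmall
  -- rewrite `S` through the Dirichlet product
  set c : ℕ → ℝ := fun n => if (n : ZMod k) = a then 1 else 0 with hc
  have hS1 : S = ∑ n ∈ Icc 1 Y, c n * ((μ : ArithmeticFunction ℝ) * friable q) n := by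
    rw [hS, Finset.sum_filter]
    refine Finset.sum_congr rfl fun n _ => ?_
    rw [← moebius_coprime_indicator_eq hq n, hc]
    by_cases h1 : (n : ZMod k) = a <;> by_cases h2 : n.Coprime q <;> simp [h1, h2]
  have hS2 : S = ∑ t ∈ Icc 1 Y, friable q t *
      ∑ w ∈ Icc 1 (Y / t), ((μ : ArithmeticFunction ℝ) w) * c (t * w) := by
    rw [hS1, mul_comm ((μ : ArithmeticFunction ℝ)) (friable q), sum_Icc_mul_dirichlet_eq]
  -- the inner sums
  set W : ℝ := C₁ * 2 ^ B * y / Real.log y ^ B + y ^ (3 / 4 : ℝ) with hW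
  have hW0 : 0 ≤ W := by positivity
  have hsqrt4 : Real.log y / 2 ≤ Real.log (Real.sqrt y) := by
    rw [Real.log_sqrt hy0.le]
  have hinner : ∀ t ∈ Icc 1 Y,
      |∑ w ∈ Icc 1 (Y / t), ((μ : ArithmeticFunction ℝ) w) * c (t * w)| ≤ W * (t : ℝ) ^ (-(1 / 2 : ℝ)) := by
    intro t ht
    rw [Finset.mem_Icc] at ht
    have ht0 : (0 : ℝ) < t := by exact_mod_cast ht.1
    have ht1 : (1 : ℝ) ≤ t := by exact_mod_cast ht.1
    -- the inner sum is a Möbius sum over a progression (or empty)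
    have hform : ∑ w ∈ Icc 1 (Y / t), ((μ : ArithmeticFunction ℝ) w) * c (t * w) =
        ∑ w ∈ (Icc 1 ⌊y / t⌋₊).filter (fun w : ℕ => ((t * w : ℕ) : ZMod k) = a), (μ w : ℝ) := by
      rw [hY, ← Nat.floor_div_natCast, Finset.sum_filter]
      refine Finset.sum_congr rfl fun w _ => ?_
      simp only [hc, ArithmeticFunction.intCoe_apply]
      split_ifs <;> simp
    rw [hform]
    have hyt2 : Real.sqrt y ≤ y / t ∨ Real.sqrt y < t := by
      by_cases hts : (t : ℝ) ≤ Real.sqrt y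
      · left
        rw [le_div_iff₀ ht0]
        calc Real.sqrt y * t ≤ Real.sqrt y * Real.sqrt y :=
              mul_le_mul_of_nonneg_left hts (Real.sqrt_nonneg y)
          _ = y := Real.mul_self_sqrt hy0.le
      · right; exact not_le.1 hts
    rcases hyt2 with hbig | hsmallt
    · -- `t ≤ √y`: Siegel–Walfisz (if `t` is a unit mod `k`) or empty
      have hsqrty : Real.exp 2 ≤ Real.sqrt y := by
        rw [← Real.exp_log (Real.sqrt_pos.2 hy0), Real.exp_le_exp]
        linarith
      have hyt : Real.exp 2 ≤ y / t := hsqrty.trans hbig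
      have hyt2' : (2 : ℝ) ≤ y / t := le_trans (by
        have := Real.add_one_le_exp (2 : ℝ); linarith) hyt
      have hlogyt : Real.log y / 2 ≤ Real.log (y / t) := by
        calc Real.log y / 2 ≤ Real.log (Real.sqrt y) := hsqrt4
          _ ≤ Real.log (y / t) := Real.log_le_log (Real.sqrt_pos.2 hy0) hbig
      have hlogyt0 : 0 < Real.log (y / t) := by linarith
      by_cases hu : IsUnit (t : ZMod k)
      · obtain ⟨u, hu⟩ := hu
        have hfilt : ∀ w : ℕ, (((t * w : ℕ) : ZMod k) = a) ↔ ((w : ZMod k) = ↑u⁻¹ * a) := by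
          intro w
          push_cast
          rw [← hu]
          constructor
          · intro h; rw [← h, ← mul_assoc, Units.inv_mul, one_mul]
          · intro h; rw [h, ← mul_assoc, Units.mul_inv, one_mul]
        simp_rw [hfilt]
        have hkA : (k : ℝ) ≤ Real.log (y / t) ^ (2 * A) := by
          calc (k : ℝ) ≤ Real.log y ^ A := hky
            _ ≤ ((Real.log y / 2) ^ (2 : ℝ)) ^ A := by
                refine Real.rpow_le_rpow hlog0.le ?_ hA.le
                rw [Real.rpow_two]
                nlinarith
            _ = (Real.log y / 2) ^ (2 * A) := by
                rw [← Real.rpow_mul (by positivity)]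
            _ ≤ Real.log (y / t) ^ (2 * A) :=
                Real.rpow_le_rpow (by positivity) hlogyt (by positivity)
        calc |∑ w ∈ (Icc 1 ⌊y / t⌋₊).filter (fun w : ℕ => (w : ZMod k) = ↑u⁻¹ * a), (μ w : ℝ)|
            ≤ C₁ * (y / t) / Real.log (y / t) ^ B := hC₁ (y / t) hyt2' k hk hkA _
          _ ≤ C₁ * (y / t) / (Real.log y / 2) ^ B := by
              refine div_le_div_of_nonneg_left (by positivity) (Real.rpow_pos_of_pos (by positivity) B) ?_
              exact Real.rpow_le_rpow (by positivity) hlogyt hB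
          _ = (C₁ * 2 ^ B * y / Real.log y ^ B) * (t : ℝ)⁻¹ := by
              rw [Real.div_rpow hlog0.le (by norm_num)]
              field_simp
          _ ≤ W * (t : ℝ)⁻¹ := by
              refine mul_le_mul_of_nonneg_right ?_ (by positivity)
              exact le_add_of_nonneg_right (by positivity)
          _ ≤ W * (t : ℝ) ^ (-(1 / 2 : ℝ)) :=
              mul_le_mul_of_nonneg_left (inv_natCast_le_rpow_neg_half t) hW0
      · -- `t` not a unit: the progression is empty
        have hempty : ∀ w : ℕ, ¬ (((t * w : ℕ) : ZMod k) = a) := by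
          intro w h
          apply hu
          push_cast at h
          rw [← h] at ha
          exact isUnit_of_mul_isUnit_left ha
        rw [Finset.filter_false_of_mem (fun w _ => hempty w), Finset.sum_empty, abs_zero]
        positivity
    · -- `t > √y`: trivial bound `≤ y/t ≤ y^{3/4} t^{-1/2}`
      calc |∑ w ∈ (Icc 1 ⌊y / t⌋₊).filter (fun w : ℕ => ((t * w : ℕ) : ZMod k) = a), (μ w : ℝ)|
          ≤ ∑ w ∈ (Icc 1 ⌊y / t⌋₊).filter (fun w : ℕ => ((t * w : ℕ) : ZMod k) = a), |(μ w : ℝ)| :=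
            Finset.abs_sum_le_sum_abs _ _
        _ ≤ ∑ w ∈ (Icc 1 ⌊y / t⌋₊).filter (fun w : ℕ => ((t * w : ℕ) : ZMod k) = a), (1 : ℝ) := by
            refine Finset.sum_le_sum fun n _ => ?_
            exact_mod_cast ArithmeticFunction.abs_moebius_le_one
        _ ≤ #(Icc 1 ⌊y / t⌋₊) := by
            rw [Finset.sum_const, nsmul_eq_mul, mul_one]
            exact_mod_cast Finset.card_le_card (Finset.filter_subset _ _)
        _ = ⌊y / t⌋₊ := by simp
        _ ≤ y / t := Nat.floor_le (by positivity)
        _ ≤ y ^ (3 / 4 : ℝ) * (t : ℝ) ^ (-(1 / 2 : ℝ)) := by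
            -- `y / t = y^{3/4} · (y^{1/4} / t) ≤ y^{3/4} t^{-1/2}` as `t ≥ √y`
            have hyq : y ^ (1 / 4 : ℝ) ≤ (t : ℝ) ^ (1 / 2 : ℝ) := by
              calc y ^ (1 / 4 : ℝ) = (Real.sqrt y) ^ (1 / 2 : ℝ) := by
                    rw [Real.sqrt_eq_rpow, ← Real.rpow_mul hy0.le]; norm_num
                _ ≤ (t : ℝ) ^ (1 / 2 : ℝ) :=
                    Real.rpow_le_rpow (Real.sqrt_nonneg y) hsmallt.le (by norm_num)
            have hsplit : y / t = y ^ (3 / 4 : ℝ) * (y ^ (1 / 4 : ℝ) * (t : ℝ)⁻¹) := by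
              rw [← mul_assoc, ← Real.rpow_add hy0]; norm_num; rw [div_eq_mul_inv]
            rw [hsplit]
            refine mul_le_mul_of_nonneg_left ?_ (by positivity)
            calc y ^ (1 / 4 : ℝ) * (t : ℝ)⁻¹ ≤ (t : ℝ) ^ (1 / 2 : ℝ) * (t : ℝ)⁻¹ :=
                  mul_le_mul_of_nonneg_right hyq (by positivity)
              _ = (t : ℝ) ^ (-(1 / 2 : ℝ)) := by
                  rw [← Real.rpow_neg_one, ← Real.rpow_add ht0]; norm_num
        _ ≤ W * (t : ℝ) ^ (-(1 / 2 : ℝ)) :=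
            mul_le_mul_of_nonneg_right (le_add_of_nonneg_left (by positivity)) (by positivity)
  -- sum over `t`
  have hfr01 : ∀ t, friable q t = 0 ∨ friable q t = 1 := by
    intro t; rw [friable_apply]; split_ifs <;> simp
  have hmain : |S| ≤ W * (4 : ℝ) ^ q.primeFactors.card := by
    rw [hS2]
    calc |∑ t ∈ Icc 1 Y, friable q t * ∑ w ∈ Icc 1 (Y / t), ((μ : ArithmeticFunction ℝ) w) * c (t * w)|
        ≤ ∑ t ∈ Icc 1 Y, |friable q t * ∑ w ∈ Icc 1 (Y / t), ((μ : ArithmeticFunction ℝ) w) * c (t * w)| :=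
          Finset.abs_sum_le_sum_abs _ _
      _ ≤ ∑ t ∈ Icc 1 Y, friable q t * (W * (t : ℝ) ^ (-(1 / 2 : ℝ))) := by
          refine Finset.sum_le_sum fun t ht => ?_
          rw [abs_mul]
          rcases hfr01 t with h0 | h1
          · rw [h0]; simp
          · rw [h1, abs_one, one_mul, one_mul]
            exact hinner t ht
      _ = W * ∑ t ∈ (Icc 1 Y).filter (fun t : ℕ => t.primeFactors ⊆ q.primeFactors),
            (t : ℝ) ^ (-(1 / 2 : ℝ)) := by
          rw [Finset.mul_sum, Finset.sum_filter]
          refine Finset.sum_congr rfl fun t ht => ?_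
          rw [Finset.mem_Icc] at ht
          rw [friable_apply]
          have ht0 : t ≠ 0 := by omega
          by_cases hsub : t.primeFactors ⊆ q.primeFactors
          · rw [if_pos ⟨ht0, hsub⟩, if_pos hsub, one_mul]
          · rw [if_neg (fun h => hsub h.2), if_neg hsub, zero_mul]
      _ ≤ W * (4 : ℝ) ^ q.primeFactors.card :=
          mul_le_mul_of_nonneg_left (sum_friable_rpow_neg_half_le q Y) hW0
  -- conclude
  have hy34 := hC₂ y hy
  calc |S| ≤ W * (4 : ℝ) ^ q.primeFactors.card := hmain
    _ ≤ (C₁ * 2 ^ B * y / Real.log y ^ B + C₂ * y / Real.log y ^ B) * (4 : ℝ) ^ q.primeFactors.card := by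
        refine mul_le_mul_of_nonneg_right ?_ (by positivity)
        exact add_le_add le_rfl hy34
    _ = (C₁ * 2 ^ B + C₂) * (4 : ℝ) ^ q.primeFactors.card * y / Real.log y ^ B := by ring
    _ ≤ ((4 : ℝ) ^ B + (C₁ * 2 ^ B + C₂)) * (4 : ℝ) ^ q.primeFactors.card * y / Real.log y ^ B := by
        refine div_le_div_of_nonneg_right ?_ (by positivity)
        refine mul_le_mul_of_nonneg_right (mul_le_mul_of_nonneg_right ?_ (by positivity)) hy0.le
        exact le_add_of_nonneg_left (by positivity)

/-- `2^{ω(q)} ≤ τ(q)` for `q ≠ 0` (real form), a one-line corollary of the tree's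
`Literature.NumberTheory.Sieve.succ_pow_card_primeFactors_le_sum_divisors` with `k = 1` (false at `q = 0`). [folklore] -/
theorem two_pow_card_primeFactors_le_sigma_zero {q : ℕ} (hq : q ≠ 0) :
    (2 : ℝ) ^ q.primeFactors.card ≤ (ArithmeticFunction.sigma 0 q : ℝ) := by
  have h := succ_pow_card_primeFactors_le_sum_divisors 1 hq
  rw [ArithmeticFunction.sigma_zero_apply]
  norm_num at h
  simpa using h

/-- `4^{ω(q)} ≤ τ(q)^2` for `q ≠ 0` (real form). [folklore] -/
theorem four_pow_card_primeFactors_le_sigma_zero_sq {q : ℕ} (hq : q ≠ 0) :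
    (4 : ℝ) ^ q.primeFactors.card ≤ (ArithmeticFunction.sigma 0 q : ℝ) ^ 2 := by
  have h := two_pow_card_primeFactors_le_sigma_zero hq
  calc (4 : ℝ) ^ q.primeFactors.card = ((2 : ℝ) ^ q.primeFactors.card) ^ 2 := by
        rw [← pow_mul, mul_comm, pow_mul]; norm_num
    _ ≤ (ArithmeticFunction.sigma 0 q : ℝ) ^ 2 := by
        gcongr

end Literature.NumberTheory.Sieve
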